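import Literature.NumberTheory.Automorphic.SymCoeffLatticeFiniteness
import Literature.NumberTheory.Automorphic.OrdinaryPartOfFiniteTypeModule
import Literature.NumberTheory.Automorphic.OrdinaryPartReductionComparison
import Literature.NumberTheory.Automorphic.LevelActionReductionKernel
import HarnessLib

/-!
# Hida's ordinary projector on `H^i(U, ⨂_τ Sym^{k−2}(𝒪²))`, `𝒪 = padicEmbInt F p`

Topic `NumberTheory/Automorphic`; namespace `Literature.NumberTheory.Automorphic.ParallelWeight`;
theorems only.  The `p`-ADIC (characteristic-`0` lattice) ordinary parts of Hida theory for
`Res_{F/ℚ} GL₂` ([Hida1994AIF, §2–3: `e` on `H^q(Y, L(n, v; 𝒪))`]; [KhareThorne2017, §6.4–6.5]) in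
the tree's coefficients-at-`p` model: for `U` open compact inside the integral monoid of the chosen
`p`-adic places and `α` in that monoid (e.g. `α = ∏_{v ∣ p} t_{v,1}`), GIVEN the Borel–Serre
finiteness fact (through `moduleFinite_latticeCohomology_of_borelSerre`) the `𝒪`-module
`H = H^i(U, ⨂_τ Sym^{k−2}(𝒪²))` is finitely generated over the `p`-adically complete discrete
valuation ring `𝒪` with finite `𝒪/pⁿ` (`finite_padicEmbInt_quotient_span_pow`), so
`OrdinaryPartOfFiniteTypeModule` applies to `T = [U α U]`:

* `bijOn_ordPart_heckeCohomology_lattice` — **`[U α U]` is bijective on `H^{ord} = ⋂ₙ range [UαU]ⁿ`**;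
* `isCompl_nilPart_ordPart_heckeCohomology_lattice` — **`H = H^{nil} ⊕ H^{ord}`** (Hida's `e`);
* `map_mkQ_ordPart_heckeCohomology_lattice` — **`H^{ord} ↠ (H/pⁿH)^{ord}`**;
* `moduleFinite_ordPart_heckeCohomology_lattice` — `H^{ord}` is finitely generated over `𝒪`;
* **`map_reduction_ordPart_lattice`** — for the reduction `r : H → H^i(U, ⨂_τ Sym((𝒪/pⁿ)²))`
  (`reductionCohomology`, kernel `pⁿH` by `ker_reductionCohomology_span_singleton`):
  **`r(H^{ord}) = H^i(U, ⨂_τ Sym((𝒪/pⁿ)²))^{ord} ∩ r(H)`** (`map_ordPart_eq_of_ker_eq`).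

## References

* H. Hida, Ann. Inst. Fourier 44 (1994), §2–3 (held). [Hida1994AIF]
* C. Khare, J. A. Thorne, Amer. J. Math. 139 (2017), §6.4–6.5 (arXiv:1409.7007, held). [KhareThorne2017]
* A. Borel, J.-P. Serre, Comment. Math. Helv. 48 (1973), §11. [BorelSerre1973]
-/

noncomputable section

open CategoryTheory IsDedekindDomain NumberField
open scoped Pointwise

namespace Literature.NumberTheory.Automorphic.ParallelWeight

open BigHeckeGLn IntegralWeightGL2 LevelAction

variable (F : Type) [Field F] [NumberField F] (k : ℕ) (p : ℕ) [Fact p.Prime]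

/-- **`𝒪 / (p)ⁿ` is finite** (`(p)ⁿ = (pⁿ)` and `finite_padicEmbIntMod`). [folklore] -/
instance finite_padicEmbInt_quotient_span_pow (n : ℕ) :
    Finite (padicEmbInt F p ⧸ Ideal.span {((p : ℕ) : padicEmbInt F p)} ^ n) :=
  Finite.of_equiv (padicEmbIntMod F p n)
    (Ideal.quotEquivOfEq (Ideal.span_singleton_pow ((p : ℕ) : padicEmbInt F p) n).symm).toEquiv

/-- `(p)ⁿ · H = pⁿ · H` (submodule versus pointwise scalar multiple). [folklore] -/
theorem span_pow_smul_top_eq (M : Type*) [AddCommGroup M] [Module (padicEmbInt F p) M] (n : ℕ) :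
    (Ideal.span {((p : ℕ) : padicEmbInt F p)} ^ n • ⊤ : Submodule (padicEmbInt F p) M) =
      (((p : ℕ) : padicEmbInt F p) ^ n) • (⊤ : Submodule (padicEmbInt F p) M) := by
  rw [Ideal.span_singleton_pow, Submodule.ideal_span_singleton_smul]

/-- The lattice cohomology `H^i(U, ⨂_τ Sym^{k−2}(𝒪²))` of the coefficients-at-`p` model
(`Γ = GL₂(F)`, integral monoid of the chosen `p`-adic places). [cite: Hida1994AIF, §1] -/
abbrev latticeCohomologyPadic (U : Subgroup (FiniteAdelicGL 2 F)) (i : ℕ) : Type :=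
  LevelAction.cohomology (globalEmbedding 2 F) (integralMonoid F (padicPlace F p))
    (symLatticeAction (padicEmbInt F p) (PadicAlgCl p) F k (padicPlace F p) (padicEmbIntHom F p)) U i

variable (hBS : BorelSerre1973_finite_groupCohomology_congruenceSubgroup)
  (U : Subgroup (FiniteAdelicGL 2 F)) (hUo : IsOpen (U : Set (FiniteAdelicGL 2 F)))
  (hUc : IsCompact (U : Set (FiniteAdelicGL 2 F)))
  (hU : U.toSubmonoid ≤ integralMonoid F (padicPlace F p)) (i : ℕ)
  {α : FiniteAdelicGL 2 F} (hα : α ∈ integralMonoid F (padicPlace F p))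

include hBS hUo hUc

/-- **`[U α U]` is bijective on `H^i(U, ⨂_τ Sym(𝒪²))^{ord}`** (given Borel–Serre finiteness).
[cite: Hida1994AIF, §2] [cite: KhareThorne2017, §6.4] -/
theorem bijOn_ordPart_heckeCohomology_lattice :
    Set.BijOn (heckeCohomology (globalEmbedding 2 F) _ _ U hU hα i)
      (ordPart (heckeCohomology (globalEmbedding 2 F) (integralMonoid F (padicPlace F p))
        (symLatticeAction (padicEmbInt F p) (PadicAlgCl p) F k (padicPlace F p) (padicEmbIntHom F p)) U hU hα i) :
        Set (latticeCohomologyPadic F k p U i))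
      (ordPart (heckeCohomology (globalEmbedding 2 F) (integralMonoid F (padicPlace F p))
        (symLatticeAction (padicEmbInt F p) (PadicAlgCl p) F k (padicPlace F p) (padicEmbIntHom F p)) U hU hα i)) := by
  haveI := moduleFinite_latticeCohomology_of_borelSerre F k p hBS U hUo hUc hU i
  haveI := (isAdicComplete_and_finite_of_moduleFinite (M := latticeCohomologyPadic F k p U i)
    (Ideal.span {((p : ℕ) : padicEmbInt F p)})).1
  haveI := (isAdicComplete_and_finite_of_moduleFinite (M := latticeCohomologyPadic F k p U i)
    (Ideal.span {((p : ℕ) : padicEmbInt F p)})).2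
  exact bijOn_ordPart (Ideal.span {((p : ℕ) : padicEmbInt F p)}) _

/-- **`H^i(U, ⨂_τ Sym(𝒪²)) = H^{nil} ⊕ H^{ord}`** for `[U α U]` (Hida's idempotent `e` on `p`-adic
cohomology; given Borel–Serre finiteness). [cite: Hida1994AIF, §2] -/
theorem isCompl_nilPart_ordPart_heckeCohomology_lattice :
    IsCompl (nilPart (Ideal.span {((p : ℕ) : padicEmbInt F p)})
        (heckeCohomology (globalEmbedding 2 F) (integralMonoid F (padicPlace F p))
          (symLatticeAction (padicEmbInt F p) (PadicAlgCl p) F k (padicPlace F p) (padicEmbIntHom F p)) U hU hα i))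
      (ordPart (heckeCohomology (globalEmbedding 2 F) (integralMonoid F (padicPlace F p))
        (symLatticeAction (padicEmbInt F p) (PadicAlgCl p) F k (padicPlace F p) (padicEmbIntHom F p)) U hU hα i)) := by
  haveI := moduleFinite_latticeCohomology_of_borelSerre F k p hBS U hUo hUc hU i
  haveI := (isAdicComplete_and_finite_of_moduleFinite (M := latticeCohomologyPadic F k p U i)
    (Ideal.span {((p : ℕ) : padicEmbInt F p)})).1
  haveI := (isAdicComplete_and_finite_of_moduleFinite (M := latticeCohomologyPadic F k p U i)
    (Ideal.span {((p : ℕ) : padicEmbInt F p)})).2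
  exact isCompl_nilPart_ordPart (Ideal.span {((p : ℕ) : padicEmbInt F p)}) _

/-- **`H^{ord} ↠ (H/pⁿH)^{ord}`** for `H = H^i(U, ⨂_τ Sym(𝒪²))` and `[U α U]` (given Borel–Serre
finiteness). [cite: Hida1994AIF, §3] -/
theorem map_mkQ_ordPart_heckeCohomology_lattice (n : ℕ) :
    (ordPart (heckeCohomology (globalEmbedding 2 F) (integralMonoid F (padicPlace F p))
        (symLatticeAction (padicEmbInt F p) (PadicAlgCl p) F k (padicPlace F p) (padicEmbIntHom F p)) U hU hα i)).map
      ((Ideal.span {((p : ℕ) : padicEmbInt F p)} ^ n • ⊤ :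
        Submodule (padicEmbInt F p) (latticeCohomologyPadic F k p U i)).mkQ) =
      ordMod (Ideal.span {((p : ℕ) : padicEmbInt F p)})
        (heckeCohomology (globalEmbedding 2 F) (integralMonoid F (padicPlace F p))
          (symLatticeAction (padicEmbInt F p) (PadicAlgCl p) F k (padicPlace F p) (padicEmbIntHom F p)) U hU hα i) n := by
  haveI := moduleFinite_latticeCohomology_of_borelSerre F k p hBS U hUo hUc hU i
  haveI := (isAdicComplete_and_finite_of_moduleFinite (M := latticeCohomologyPadic F k p U i)
    (Ideal.span {((p : ℕ) : padicEmbInt F p)})).1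
  haveI := (isAdicComplete_and_finite_of_moduleFinite (M := latticeCohomologyPadic F k p U i)
    (Ideal.span {((p : ℕ) : padicEmbInt F p)})).2
  exact map_mkQ_ordPart (Ideal.span {((p : ℕ) : padicEmbInt F p)}) _ n

/-- `H^i(U, ⨂_τ Sym(𝒪²))^{ord}` is finitely generated over `𝒪` (given Borel–Serre finiteness).
[folklore] -/
theorem moduleFinite_ordPart_heckeCohomology_lattice :
    Module.Finite (padicEmbInt F p)
      (ordPart (heckeCohomology (globalEmbedding 2 F) (integralMonoid F (padicPlace F p))
        (symLatticeAction (padicEmbInt F p) (PadicAlgCl p) F k (padicPlace F p) (padicEmbIntHom F p)) U hU hα i)) := by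
  haveI := moduleFinite_latticeCohomology_of_borelSerre F k p hBS U hUo hUc hU i
  exact moduleFinite_ordPart _

/-- **`r(H^{ord}) = H^i(U, ⨂_τ Sym((𝒪/pⁿ)²))^{ord} ∩ r(H)`** for the reduction
`r : H = H^i(U, ⨂_τ Sym(𝒪²)) → H^i(U, ⨂_τ Sym((𝒪/pⁿ)²))` and `[U α U]` (given Borel–Serre
finiteness): the ordinary part of the mod-`pⁿ` cohomology meets the image of `H` exactly in the
reduction of the `p`-adic ordinary part. [cite: Hida1994AIF, §3] [cite: KhareThorne2017, §6.4] -/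
theorem map_reduction_ordPart_lattice (n : ℕ) :
    (ordPart (heckeCohomology (globalEmbedding 2 F) (integralMonoid F (padicPlace F p))
        (symLatticeAction (padicEmbInt F p) (PadicAlgCl p) F k (padicPlace F p) (padicEmbIntHom F p)) U hU hα i)).map
      (reductionCohomology (padicEmbInt F p) (PadicAlgCl p) F k (padicPlace F p) (padicEmbIntHom F p)
        (Ideal.span {((p : ℕ) : padicEmbInt F p) ^ n}) (globalEmbedding 2 F) hU i) =
      ordPart (heckeCohomology (globalEmbedding 2 F) (integralMonoid F (padicPlace F p))
          (symLatticeAction (padicEmbInt F p ⧸ Ideal.span {((p : ℕ) : padicEmbInt F p) ^ n}) (PadicAlgCl p) F k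
            (padicPlace F p)
            (fun τ => (Ideal.Quotient.mk (Ideal.span {((p : ℕ) : padicEmbInt F p) ^ n})).comp (padicEmbIntHom F p τ)))
          U hU hα i) ⊓
        LinearMap.range (reductionCohomology (padicEmbInt F p) (PadicAlgCl p) F k (padicPlace F p) (padicEmbIntHom F p)
          (Ideal.span {((p : ℕ) : padicEmbInt F p) ^ n}) (globalEmbedding 2 F) hU i) := by
  haveI := moduleFinite_latticeCohomology_of_borelSerre F k p hBS U hUo hUc hU i
  haveI : IsAdicComplete (Ideal.span {((p : ℕ) : padicEmbInt F p)}) (latticeCohomologyPadic F k p U i) :=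
    isAdicComplete_of_moduleFinite _ (IsAdicComplete.le_jacobson_bot _)
  haveI : ∀ m : ℕ, Finite (latticeCohomologyPadic F k p U i ⧸
      (Ideal.span {((p : ℕ) : padicEmbInt F p)} ^ m • ⊤ : Submodule (padicEmbInt F p) (latticeCohomologyPadic F k p U i))) :=
    fun m => finite_quotient_pow_smul_top _ m
  haveI : Finite (LevelAction.cohomology (globalEmbedding 2 F) (integralMonoid F (padicPlace F p))
      (symLatticeAction (padicEmbInt F p ⧸ Ideal.span {((p : ℕ) : padicEmbInt F p) ^ n}) (PadicAlgCl p) F k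
        (padicPlace F p)
        (fun τ => (Ideal.Quotient.mk (Ideal.span {((p : ℕ) : padicEmbInt F p) ^ n})).comp (padicEmbIntHom F p τ)))
      U i) :=
    finite_latticeCohomology_of_borelSerre (padicEmbIntMod F p n) (PadicAlgCl p) F k hBS (padicPlace F p) _ U hUo hUc hU i
  refine map_ordPart_eq_of_ker_eq (Ideal.span {((p : ℕ) : padicEmbInt F p)}) _ _ _
    (fun x => reductionCohomology_heckeCohomology _ _ F k _ _ _ _ hU i hα x) n ?_
  rw [ker_reductionCohomology_span_singleton _ _ F k _ _ _ _ hU i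
    (pow_ne_zero n (natCast_prime_padicEmbInt_ne_zero F p)), span_pow_smul_top_eq]

end Literature.NumberTheory.Automorphic.ParallelWeight
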